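import Summits.KontsevichZagierPeriods.KontsevichZagierPeriods.Theorems.RootDecompWalshStrataArcBridge
import Summits.KontsevichZagierPeriods.KontsevichZagierPeriods.Theorems.RootDecompWalshStrataParab4Baker
import Summits.KontsevichZagierPeriods.KontsevichZagierPeriods.Theorems.RootDecompWalshStrataCone4Baker
import Summits.KontsevichZagierPeriods.KontsevichZagierPeriods.Theorems.RootDecompWalshStrataDecompTwo

/-!
# The `π`-polynomial class of quadric cells: the weight-two wall of the `d = 4` rung DECIDED for the ball genus

Route `RootDecompWalshStrata` (cell decomp-kz, lens 4, gen 12), support toward `QuadricSignKernel`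
(item stmt-KontsevichZagierPeriods-25393), rung `d ≤ 4` (`QuadricFourRung`).  GEN 11 left the node
`QuadricFour ⟸ RationalTwoKernel ∧ QuadricBakerDescent ∧ ∀ P (weight-one class ∨ weight-two class)`
with the oracle `RationalTwoKernel` load-bearing exactly on the weight-two cells (4-ball `q·π²/32`,
split quadric).  GEN 12: the SECTOR CLASS `QuadricDescentAt S P` («every constant-weight cell of `P`
descends modulo `KZ.relations` into the span of `S`», any sector `S`; the gen-11 classes are
its instances) with its rule-bookkeeping (standard cell, coordinate permutations, box reflections) done ONCE,
and the instance `S = Π` (the `π`-polynomial sector of `PiSector`, on which Conjecture 1 in kernel form is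
the THEOREM `piKernel`): the 4-BALL (`[B⁴₊, q] ≡ [arc,1]·[arc,q/2] ≡ [hq,1]·[hq,q/2] = hq2Rep (q/2)`), the
SOLID PARABOLOID and the LORENTZIAN CONE (`≡ arcRep w ≡ hqRep w`) lie in the `Π`-class, INSIDE the three
rules.  CONSEQUENCE (`sum_mem_relations_ball4`, `sum_mem_relations_ball4_parab4_cone4`): **Conjecture 1
in kernel form HOLDS OUTRIGHT — standard axioms, no oracle — for every family of constant-weight 4-cells
drawn from the permuted / reflected balls, paraboloids and cones, weights ONE AND TWO mixed** (values in
`ℚπ + ℚπ²`; the gen-11 theorem `DecompTwo.sum_mem_relations_ball4_of_decompKernel` loses its hypothesis).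
The node sharpens to `quadricFour_of_descentAt`: `QuadricFour ⟸` (kernel on ONE sector `S`) `∧`
(every quadric of dimension `≤ 4` in the `S`-class); with `S = B ∪ Π` (`B` = Baker) the only
transcendence input still missing is «`π² ∉ ℚ + ℚπ + Σ ℚ·log αᵢ`» for the MIXED ball-with-logarithm
families, and Euler's accessible identity for the split cell (`Split4Euler`).  0 sorry.
[KontsevichZagier2001 §1.1–§1.2, §4.1; Lindemann1882; Baker1975 Thm 2.1; this node]
-/

noncomputable section

open Literature.NumberTheory.Transcendental
open MeasureTheory Set
open MvPolynomial (aeval X C rename bind₁)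
open Summit.KontsevichZagierPeriods.RootDecompWalshStrata.WalshSpanProof (cellRep cellRep_domain
  cellRep_integrand)
open Summit.KontsevichZagierPeriods.RootDecompWalshStrata.FourSym (of_sub_of_cellRep_mem_relations
  reindex_cellRep_rename totalDegree_le_totalDegree_rename cellRep_reflect_domain)
open Summit.KontsevichZagierPeriods.RootDecompWalshStrata.QuadricFourRung (QuadricFour
  totalDegree_ball4Poly_le totalDegree_parab4Poly_le totalDegree_cone4Poly_le)
open Summit.KontsevichZagierPeriods.RootDecompWalshStrata.Ball4 (ball4Poly arcRep)
open Summit.KontsevichZagierPeriods.RootDecompWalshStrata.Parab4 (parab4Poly)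
open Summit.KontsevichZagierPeriods.RootDecompWalshStrata.Cone4 (cone4Poly)
open Summit.KontsevichZagierPeriods.RootDecompWalshStrata.BakerAt (QuadricBakerDescentAt)
open Summit.KontsevichZagierPeriods.RootDecompWalshStrata.DecompTwo (bakerGens sum_mem_relations_of_descent
  of_cell_sub_of_mul_mem_relations)
open Summit.KontsevichZagierPeriods.RootDecompWalshStrata.PiSector (piGens piKernel hqRep hq2Rep
  of_hqRep_mul_of_hqRep of_hq2Rep_mem_piGens of_arcRep_sub_of_hqRep_mem_relations exists_pi_of_sub_arcRep)

namespace Summit.KontsevichZagierPeriods.RootDecompWalshStrata.PiAt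

/-! #### The sector class of a quadric -/

/-- **`QuadricDescentAt S P`** — the `S`-CLASS of the quadric `P` (any dimension `d`, any sector
`S ⊆ 𝓟_KZ`): every representation with domain `(0,1)^d ∩ {P > 0}` and constant rational weight descends,
modulo `KZ.relations`, into the `ℤ`-span of `S`.  (`S` = Baker generators: the gen-11 weight-one class
`QuadricBakerDescentAt`; `S` = rational `dim ≤ 2` classes: `QuadricTwoDescentFourAt`; `S = Π`: below.)
[KontsevichZagier2001 §1.2] -/
@[conjecture] def QuadricDescentAt (S : Set KZ.FormalRep) {d : ℕ} (P : MvPolynomial (Fin d) ℚ) : Prop :=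
  ∀ (q : ℚ) (ρ : KZ.IntegralRep d),
    (ρ.domain = {x | (∀ j, 0 < x j ∧ x j < 1) ∧ 0 < MvPolynomial.aeval x P} ∧
      ∀ x ∈ ρ.domain, ρ.integrand x = (q : ℝ)) →
    P.totalDegree ≤ 2 → ∃ y ∈ AddSubgroup.closure S, KZ.of ρ - y ∈ KZ.relations

/-- The gen-11 weight-one class is the Baker-sector class. [definition] -/
theorem bakerDescentAt_iff {d : ℕ} (P : MvPolynomial (Fin d) ℚ) :
    QuadricBakerDescentAt P ↔ QuadricDescentAt bakerGens P := Iff.rfl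

/-- The class grows with the sector. [definition] -/
theorem descentAt_mono {S T : Set KZ.FormalRep} (hST : S ⊆ T) {d : ℕ} {P : MvPolynomial (Fin d) ℚ}
    (h : QuadricDescentAt S P) : QuadricDescentAt T P := fun q ρ hρ hdeg => by
  obtain ⟨y, hy, hrel⟩ := h q ρ hρ hdeg
  exact ⟨y, AddSubgroup.closure_mono hST hy, hrel⟩

/-- **THE MECHANISM.** If Conjecture 1 in kernel form holds on the sector `S`, every vanishing
`ℤ`-combination of constant-weight quadric cells all of whose quadrics lie in the `S`-class is a
Kontsevich–Zagier relation (descend; the descended combination has value `0`; apply the kernel; the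
difference is a relation). [KontsevichZagier2001 §1.2; this node] -/
theorem sum_mem_relations_of_descentAt {S : Set KZ.FormalRep}
    (hK : ∀ ⦃x : KZ.FormalRep⦄, x ∈ AddSubgroup.closure S → KZ.eval x = 0 → x ∈ KZ.relations)
    (k : ℕ) (d : Fin k → ℕ) (P : (i : Fin k) → MvPolynomial (Fin (d i)) ℚ) (q : Fin k → ℚ)
    (ρ : (i : Fin k) → KZ.IntegralRep (d i)) (c : Fin k → ℤ) (hW : ∀ i, QuadricDescentAt S (P i))
    (hρ : ∀ i, (ρ i).domain = {x | (∀ j, 0 < x j ∧ x j < 1) ∧ 0 < MvPolynomial.aeval x (P i)} ∧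
      ∀ x ∈ (ρ i).domain, (ρ i).integrand x = (q i : ℝ))
    (hdeg : ∀ i, (P i).totalDegree ≤ 2) (hv : KZ.eval (∑ i, c i • KZ.of (ρ i)) = 0) :
    (∑ i, c i • KZ.of (ρ i)) ∈ KZ.relations := by
  choose y hy hrel using fun i => hW i (q i) (ρ i) (hρ i) (hdeg i)
  exact sum_mem_relations_of_descent hK k d ρ c y hy hrel hv

/-- **The node, sector form: `QuadricFour ⟸` (kernel on `S`) `∧` (every quadric of dimension `≤ 4` is
in the `S`-class).** [KontsevichZagier2001 §1.2; this node] -/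
theorem quadricFour_of_descentAt {S : Set KZ.FormalRep}
    (hK : ∀ ⦃x : KZ.FormalRep⦄, x ∈ AddSubgroup.closure S → KZ.eval x = 0 → x ∈ KZ.relations)
    (h : ∀ d, d ≤ 4 → ∀ P : MvPolynomial (Fin d) ℚ, QuadricDescentAt S P) : QuadricFour :=
  fun k d P q ρ c hρ hdeg hd hv =>
    sum_mem_relations_of_descentAt hK k d P q ρ c (fun i => h (d i) (hd i) (P i)) hρ hdeg hv

/-! #### Rule bookkeeping for the class, once and for all sectors -/

/-- To put `P` in the `S`-class it suffices to descend the standard cell `cellRep P q` for every `q`.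
[KontsevichZagier2001 §1.2 rule (1)] -/
theorem descentAt_of_cellRep {S : Set KZ.FormalRep} {d : ℕ} {P : MvPolynomial (Fin d) ℚ}
    (h : P.totalDegree ≤ 2 → ∀ q : ℚ, ∃ y ∈ AddSubgroup.closure S,
      KZ.of (cellRep P q) - y ∈ KZ.relations) : QuadricDescentAt S P := by
  intro q ρ hρ hdeg
  obtain ⟨y, hy, hrel⟩ := h hdeg q
  refine ⟨y, hy, ?_⟩
  have : KZ.of ρ - y = (KZ.of ρ - KZ.of (cellRep P q)) + (KZ.of (cellRep P q) - y) := by abel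
  rw [this]
  exact add_mem (of_sub_of_cellRep_mem_relations P q ρ hρ) hrel

/-- A member of the class descends its standard cells. [KontsevichZagier2001 §1.2] -/
theorem exists_descent_cellRep {S : Set KZ.FormalRep} {d : ℕ} {P : MvPolynomial (Fin d) ℚ}
    (h : QuadricDescentAt S P) (hdeg : P.totalDegree ≤ 2) (q : ℚ) :
    ∃ y ∈ AddSubgroup.closure S, KZ.of (cellRep P q) - y ∈ KZ.relations :=
  h q (cellRep P q) ⟨cellRep_domain P q, fun x _ => cellRep_integrand P q x⟩ hdeg

/-- **Closure under coordinate permutations** (rule (2), `KZ.permRel`). [KontsevichZagier2001 §1.2 rule (2)] -/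
theorem descentAt_rename {S : Set KZ.FormalRep} {d : ℕ} {P : MvPolynomial (Fin d) ℚ}
    (σ : Equiv.Perm (Fin d)) (h : QuadricDescentAt S P) : QuadricDescentAt S (rename σ P) := by
  refine descentAt_of_cellRep fun hdeg' q => ?_
  have hdeg : P.totalDegree ≤ 2 := (totalDegree_le_totalDegree_rename σ P).trans hdeg'
  set r := cellRep (rename σ P) q with hr
  obtain ⟨y, hy, hrel⟩ := h q (r.reindex σ.symm) (reindex_cellRep_rename σ P q) hdeg
  refine ⟨y, hy, ?_⟩
  have hperm : KZ.of r - KZ.of (r.reindex σ.symm) ∈ KZ.relations :=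
    KZ.permRel_subset_relations (KZ.of_sub_of_reindex_mem_permRel r σ.symm)
  have : KZ.of r - y = (KZ.of r - KZ.of (r.reindex σ.symm)) + (KZ.of (r.reindex σ.symm) - y) := by
    abel
  rw [this]
  exact add_mem hperm hrel

/-- **Closure under the face reflections `xⱼ ↦ 1 − xⱼ`** (rule (2)). [KontsevichZagier2001 §1.2 rule (2)] -/
theorem descentAt_reflect {S : Set KZ.FormalRep} {d : ℕ} {P : MvPolynomial (Fin d) ℚ} (j : Fin d)
    (hdeg : P.totalDegree ≤ 2) (h : QuadricDescentAt S P) :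
    QuadricDescentAt S (bind₁ (KZ.reflectSubst j) P) := by
  refine descentAt_of_cellRep fun _ q => ?_
  obtain ⟨y, hy, hrel⟩ := exists_descent_cellRep h hdeg q
  refine ⟨y, hy, ?_⟩
  have hrefl : KZ.of (cellRep (bind₁ (KZ.reflectSubst j) P) q) - KZ.of (cellRep P q) ∈
      KZ.relations :=
    KZ.of_sub_of_mem_relations_of_boxReflection j (cellRep_reflect_domain j P q) fun x _ => by
      rw [cellRep_integrand, cellRep_integrand]
  have : KZ.of (cellRep (bind₁ (KZ.reflectSubst j) P) q) - y =
      (KZ.of (cellRep (bind₁ (KZ.reflectSubst j) P) q) - KZ.of (cellRep P q)) +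
        (KZ.of (cellRep P q) - y) := by abel
  rw [this]
  exact add_mem hrefl hrel

/-- Permutations of reflections stay in the class. [KontsevichZagier2001 §1.2 rule (2)] -/
theorem descentAt_rename_reflect {S : Set KZ.FormalRep} {d : ℕ} {P : MvPolynomial (Fin d) ℚ}
    (σ : Equiv.Perm (Fin d)) (j : Fin d) (hdeg : P.totalDegree ≤ 2) (h : QuadricDescentAt S P) :
    QuadricDescentAt S (rename σ (bind₁ (KZ.reflectSubst j) P)) :=
  descentAt_rename σ (descentAt_reflect j hdeg h)

/-- A substitution by polynomials of degree `≤ 1` does not raise the total degree. [folklore] -/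
theorem totalDegree_bind₁_le_of_le_one {R : Type*} [CommSemiring R] {σ τ : Type*}
    (θ : σ → MvPolynomial τ R) (hθ : ∀ i, (θ i).totalDegree ≤ 1) (p : MvPolynomial σ R) :
    (bind₁ θ p).totalDegree ≤ p.totalDegree := by
  classical
  conv_lhs => rw [p.as_sum]
  rw [map_sum]
  refine (MvPolynomial.totalDegree_finsetSum _ _).trans (Finset.sup_le fun d hd => ?_)
  rw [MvPolynomial.bind₁_monomial]
  refine (MvPolynomial.totalDegree_mul _ _).trans ?_
  rw [MvPolynomial.totalDegree_C, zero_add]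
  refine (MvPolynomial.totalDegree_finsetProd _ _).trans ?_
  calc ∑ i ∈ d.support, (θ i ^ d i).totalDegree ≤ ∑ i ∈ d.support, d i :=
        Finset.sum_le_sum fun i _ => (MvPolynomial.totalDegree_pow _ _).trans
          (by simpa using Nat.mul_le_mul_left (d i) (hθ i))
    _ ≤ p.totalDegree := MvPolynomial.le_totalDegree hd

/-- **A box reflection does not raise the degree of a quadric.** [folklore] -/
theorem totalDegree_reflect_le {N : ℕ} (j : Fin N) (Q : MvPolynomial (Fin N) ℚ) :
    (bind₁ (KZ.reflectSubst j) Q).totalDegree ≤ Q.totalDegree := by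
  refine totalDegree_bind₁_le_of_le_one _ (fun i => ?_) Q
  unfold KZ.reflectSubst
  split_ifs
  · exact (MvPolynomial.totalDegree_sub _ _).trans
      (max_le (by simp) (by simp [MvPolynomial.totalDegree_X]))
  · simp [MvPolynomial.totalDegree_X]

/-! #### The `Π`-class: paraboloid, cone (weight one) and BALL (weight two) -/

/-- **The solid paraboloid is in the `Π`-class** (`[cell, q] ≡ arcRep (4q/15) ≡ hqRep (4q/15)`).
[KontsevichZagier2001 §1.2; this node] -/
theorem piDescentAt_parab4 : QuadricDescentAt piGens parab4Poly :=
  descentAt_of_cellRep fun _ q => exists_pi_of_sub_arcRep (Parab4.of_cell_sub_of_arcRep_mem_relations q)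

/-- **The Lorentzian cone is in the `Π`-class** (`[cell, q] ≡ arcRep (q/6) ≡ hqRep (q/6)`).
[KontsevichZagier2001 §1.2; this node] -/
theorem piDescentAt_cone4 : QuadricDescentAt piGens cone4Poly :=
  descentAt_of_cellRep fun _ q => exists_pi_of_sub_arcRep (Cone4.of_cell_sub_of_arcRep_mem_relations q)

/-- **`[(0,1)⁴ ∩ {Σ xᵢ² < 1}, q] − [hq2Rep (q/2)] ∈ KZ.relations`:** the 4-ball cell IS, modulo the
three rules, the square generator of `Π` (`q·π²/32` both sides): gen-11's `[B⁴₊,q] ≡ [arc,1]·[arc,q/2]`,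
the arc bridge on each factor (products respect relations: `KZ.mul_sub_mul_mem_relations`), and
`[hq,1]·[hq,q/2] = [hq2Rep (q/2)]`. [KontsevichZagier2001 §1.2, §4.1; this node] -/
theorem of_ball4_cell_sub_of_hq2Rep_mem_relations (q : ℚ) :
    KZ.of (cellRep ball4Poly q) - KZ.of (hq2Rep (q / 2)) ∈ KZ.relations := by
  have h1 := of_cell_sub_of_mul_mem_relations q
  have h2 : KZ.of (arcRep 1) * KZ.of (arcRep (q / 2)) - KZ.of (hqRep 1) * KZ.of (hqRep (q / 2)) ∈
      KZ.relations :=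
    KZ.mul_sub_mul_mem_relations (of_arcRep_sub_of_hqRep_mem_relations 1)
      (of_arcRep_sub_of_hqRep_mem_relations (q / 2))
  rw [of_hqRep_mul_of_hqRep] at h2
  have : KZ.of (cellRep ball4Poly q) - KZ.of (hq2Rep (q / 2)) =
      (KZ.of (cellRep ball4Poly q) - KZ.of (arcRep 1) * KZ.of (arcRep (q / 2))) +
        (KZ.of (arcRep 1) * KZ.of (arcRep (q / 2)) - KZ.of (hq2Rep (q / 2))) := by abel
  rw [this]
  exact add_mem h1 h2

/-- **The 4-ball is in the `Π`-class** — a WEIGHT-TWO cell descended, inside the rules, into a sector on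
which the kernel statement is a theorem. [KontsevichZagier2001 §1.2, §4.1; this node] -/
theorem piDescentAt_ball4 : QuadricDescentAt piGens ball4Poly :=
  descentAt_of_cellRep fun _ q => ⟨KZ.of (hq2Rep (q / 2)),
    AddSubgroup.subset_closure (of_hq2Rep_mem_piGens _), of_ball4_cell_sub_of_hq2Rep_mem_relations q⟩

/-- Permuted / reflected balls are in the `Π`-class. [this node] -/
theorem piDescentAt_ball4_rename_reflect (σ : Equiv.Perm (Fin 4)) (j : Fin 4) :
    QuadricDescentAt piGens (rename σ (bind₁ (KZ.reflectSubst j) ball4Poly)) :=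
  descentAt_rename_reflect σ j totalDegree_ball4Poly_le piDescentAt_ball4
/-- Permuted / reflected paraboloids are in the `Π`-class. [this node] -/
theorem piDescentAt_parab4_rename_reflect (σ : Equiv.Perm (Fin 4)) (j : Fin 4) :
    QuadricDescentAt piGens (rename σ (bind₁ (KZ.reflectSubst j) parab4Poly)) :=
  descentAt_rename_reflect σ j totalDegree_parab4Poly_le piDescentAt_parab4
/-- Permuted / reflected cones are in the `Π`-class. [this node] -/
theorem piDescentAt_cone4_rename_reflect (σ : Equiv.Perm (Fin 4)) (j : Fin 4) :
    QuadricDescentAt piGens (rename σ (bind₁ (KZ.reflectSubst j) cone4Poly)) :=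
  descentAt_rename_reflect σ j totalDegree_cone4Poly_le piDescentAt_cone4
/-- Permuted balls are in the `Π`-class. [this node] -/
theorem piDescentAt_ball4_rename (σ : Equiv.Perm (Fin 4)) :
    QuadricDescentAt piGens (rename σ ball4Poly) := descentAt_rename σ piDescentAt_ball4
/-- Permuted paraboloids are in the `Π`-class. [this node] -/
theorem piDescentAt_parab4_rename (σ : Equiv.Perm (Fin 4)) :
    QuadricDescentAt piGens (rename σ parab4Poly) := descentAt_rename σ piDescentAt_parab4
/-- Permuted cones are in the `Π`-class. [this node] -/
theorem piDescentAt_cone4_rename (σ : Equiv.Perm (Fin 4)) :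
    QuadricDescentAt piGens (rename σ cone4Poly) := descentAt_rename σ piDescentAt_cone4

/-! #### Unconditional kernel statements -/

/-- **Conjecture 1 (kernel form) for the `Π`-class, UNCONDITIONALLY** (any dimensions, any number of
cells, weights one and two mixed): the kernel on `Π` is the theorem `piKernel` (transcendence of `π`).
[Lindemann1882; KontsevichZagier2001 §1.2; this node] -/
theorem sum_mem_relations_pi (k : ℕ) (d : Fin k → ℕ) (P : (i : Fin k) → MvPolynomial (Fin (d i)) ℚ)
    (q : Fin k → ℚ) (ρ : (i : Fin k) → KZ.IntegralRep (d i)) (c : Fin k → ℤ)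
    (hW : ∀ i, QuadricDescentAt piGens (P i))
    (hρ : ∀ i, (ρ i).domain = {x | (∀ j, 0 < x j ∧ x j < 1) ∧ 0 < MvPolynomial.aeval x (P i)} ∧
      ∀ x ∈ (ρ i).domain, (ρ i).integrand x = (q i : ℝ))
    (hdeg : ∀ i, (P i).totalDegree ≤ 2) (hv : KZ.eval (∑ i, c i • KZ.of (ρ i)) = 0) :
    (∑ i, c i • KZ.of (ρ i)) ∈ KZ.relations :=
  sum_mem_relations_of_descentAt piKernel k d P q ρ c hW hρ hdeg hv

/-- **Conjecture 1 (kernel form) HOLDS for every family of 4-ball cells `[(0,1)⁴ ∩ {Σxᵢ² < 1}, qᵢ]` —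
NO ORACLE** (gen 11 needed `DecomposableTwoKernel` here: `DecompTwo.sum_mem_relations_ball4_of_decompKernel`).
[Lindemann1882; KontsevichZagier2001 §1.2, §4.1; this node] -/
theorem sum_mem_relations_ball4 (k : ℕ) (q : Fin k → ℚ) (ρ : Fin k → KZ.IntegralRep 4) (c : Fin k → ℤ)
    (hρ : ∀ i, (ρ i).domain = {x | (∀ j, 0 < x j ∧ x j < 1) ∧ 0 < MvPolynomial.aeval x ball4Poly} ∧
      ∀ x ∈ (ρ i).domain, (ρ i).integrand x = (q i : ℝ))
    (hv : KZ.eval (∑ i, c i • KZ.of (ρ i)) = 0) : (∑ i, c i • KZ.of (ρ i)) ∈ KZ.relations :=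
  sum_mem_relations_pi k (fun _ => 4) (fun _ => ball4Poly) q ρ c (fun _ => piDescentAt_ball4) hρ
    (fun _ => totalDegree_ball4Poly_le) hv

/-- **Conjecture 1 (kernel form) HOLDS, unconditionally, for every MIXED family of constant-weight
4-cells cut out by coordinate permutations of box reflections of the BALL `Σxᵢ² < 1` (weight two,
`ℚπ²`), the PARABOLOID `x₃ > Σxᵢ²` and the CONE `x₃² > Σxᵢ²` (weight one, `ℚπ`)** — `π` and `π²`
together, beyond the reach of the dimension-one (Baker) kernel. [Lindemann1882; KontsevichZagier2001 §1.2; this node] -/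
theorem sum_mem_relations_ball4_parab4_cone4 (k : ℕ) (P : Fin k → MvPolynomial (Fin 4) ℚ)
    (q : Fin k → ℚ) (ρ : Fin k → KZ.IntegralRep 4) (c : Fin k → ℤ)
    (hP : ∀ i, ∃ (σ : Equiv.Perm (Fin 4)) (j : Fin 4),
      P i = rename σ ball4Poly ∨ P i = rename σ parab4Poly ∨ P i = rename σ cone4Poly ∨
      P i = rename σ (bind₁ (KZ.reflectSubst j) ball4Poly) ∨
      P i = rename σ (bind₁ (KZ.reflectSubst j) parab4Poly) ∨
      P i = rename σ (bind₁ (KZ.reflectSubst j) cone4Poly))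
    (hρ : ∀ i, (ρ i).domain = {x | (∀ j, 0 < x j ∧ x j < 1) ∧ 0 < MvPolynomial.aeval x (P i)} ∧
      ∀ x ∈ (ρ i).domain, (ρ i).integrand x = (q i : ℝ))
    (hv : KZ.eval (∑ i, c i • KZ.of (ρ i)) = 0) : (∑ i, c i • KZ.of (ρ i)) ∈ KZ.relations := by
  have hdeg_refl : ∀ (j : Fin 4) (Q : MvPolynomial (Fin 4) ℚ), Q.totalDegree ≤ 2 →
      (bind₁ (KZ.reflectSubst j) Q).totalDegree ≤ 2 := fun j Q hQ =>
    (totalDegree_reflect_le j Q).trans hQ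
  refine sum_mem_relations_pi k (fun _ => 4) P q ρ c (fun i => ?_) hρ (fun i => ?_) hv
  · obtain ⟨σ, j, h | h | h | h | h | h⟩ := hP i <;> rw [h]
    · exact piDescentAt_ball4_rename σ
    · exact piDescentAt_parab4_rename σ
    · exact piDescentAt_cone4_rename σ
    · exact piDescentAt_ball4_rename_reflect σ j
    · exact piDescentAt_parab4_rename_reflect σ j
    · exact piDescentAt_cone4_rename_reflect σ j
  · obtain ⟨σ, j, h | h | h | h | h | h⟩ := hP i <;> rw [h] <;>
      refine (MvPolynomial.totalDegree_rename_le _ _).trans ?_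
    · exact totalDegree_ball4Poly_le
    · exact totalDegree_parab4Poly_le
    · exact totalDegree_cone4Poly_le
    · exact hdeg_refl j _ totalDegree_ball4Poly_le
    · exact hdeg_refl j _ totalDegree_parab4Poly_le
    · exact hdeg_refl j _ totalDegree_cone4Poly_le

/-! #### What is left of the oracle: the joint sector `B ∪ Π` -/

/-- **`JointKernel`** — Conjecture 1 in kernel form on the sector generated by the Baker generators
(rational, dimension `≤ 1`; values `ℚ + ℚπ + Σ ℚ·log αᵢ`) AND the `π`-polynomial sector `Π` (`+ ℚπ²`).
Its only content beyond Baker's theorem and `piKernel` is «`π² ∉ ℚ + ℚπ + Σ ℚ·log αᵢ`» (a consequence of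
Schanuel's conjecture; open).  This — not `RationalTwoKernel` — is what the MIXED families
«ball cells + logarithmic weight-one cells» of the `d = 4` rung need. [Baker1975 Thm 2.1; KontsevichZagier2001 §1.2; this node] -/
@[conjecture] def JointKernel : Prop :=
  ∀ ⦃x : KZ.FormalRep⦄, x ∈ AddSubgroup.closure (bakerGens ∪ piGens) → KZ.eval x = 0 →
    x ∈ KZ.relations

/-- The weight-one class lies in the joint class. [definition] -/
theorem jointDescentAt_of_bakerDescentAt {d : ℕ} {P : MvPolynomial (Fin d) ℚ}
    (h : QuadricBakerDescentAt P) : QuadricDescentAt (bakerGens ∪ piGens) P :=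
  descentAt_mono subset_union_left ((bakerDescentAt_iff P).1 h)

/-- The `Π`-class lies in the joint class. [definition] -/
theorem jointDescentAt_of_piDescentAt {d : ℕ} {P : MvPolynomial (Fin d) ℚ}
    (h : QuadricDescentAt piGens P) : QuadricDescentAt (bakerGens ∪ piGens) P :=
  descentAt_mono subset_union_right h

/-- **The node after gen 12, joint form:** `QuadricFour ⟸ JointKernel ∧` (every quadric of dimension
`≤ 4` is in the weight-one class or in the `Π`-class or, more generally, in the joint class).
[KontsevichZagier2001 §1.2; this node] -/
theorem quadricFour_of_jointKernel (hJ : JointKernel)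
    (h : ∀ d, d ≤ 4 → ∀ P : MvPolynomial (Fin d) ℚ,
      QuadricBakerDescentAt P ∨ QuadricDescentAt piGens P ∨ QuadricDescentAt (bakerGens ∪ piGens) P) :
    QuadricFour :=
  quadricFour_of_descentAt hJ fun d hd P => by
    rcases h d hd P with h | h | h
    · exact jointDescentAt_of_bakerDescentAt h
    · exact jointDescentAt_of_piDescentAt h
    · exact h

end Summit.KontsevichZagierPeriods.RootDecompWalshStrata.PiAt

end
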